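import Summits.BirchSwinnertonDyer.BirchSwinnertonDyer.Theorems.PrintCf2SplitBadTwoH2AboveLineTateHolds
import Summits.BirchSwinnertonDyer.BirchSwinnertonDyer.Theorems.PrintCf2SplitBadTwoLineKernelOfFrame
import Summits.BirchSwinnertonDyer.BirchSwinnertonDyer.Theorems.PrintCf2RubinValueTwoPinnedSummandTwistedMCShape
import Literature.GroupTheory.Abelian.CocyclicPruferUniqueness
import HarnessLib

/-!
# `H²(Gal(K̄/K*_∞), W*) = 0` for the PINNED CM summand `W* = W[v̄^∞]` above road α's `v̄`-line
# (crux `PrintCf2.SplitBadTwoRankOneOfFacts`, stmt-BirchSwinnertonDyer-20368; the `h2` binder of the (REG_W) chain)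

Cell `bsd-print-cf2`, EXTRA WIDTH seat `bsd-line-cf2-p1-w4` g12 (prover-bsd-line-cf2-p1-w4-g12-0); `--supports stmt-BirchSwinnertonDyer-20368`
(helper, Theses-free). HONEST FRAMING: nothing here closes the crux or a registered stub; BSD is not proved by any of this; no summit statement
is proved by this seat. No definition, no named fact, no `sorry`. UNCONDITIONAL (the Tate input is the tree's `H2AboveLine.hTate_holds`).

WHAT. The (REG_W) chain of this seat (p700332 `X_regular_of_subsingleton_H2_of_layers_of_isTopGeneratorPair` at `M = W*`) displays
`h2 : Subsingleton (H²(ker κ₂, W*))`. -w5 g4's leaf (A′) `H2AboveLine.subsingleton_H2_kerSubgroup_charModule` proves this for the sign modules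
`A_θ` (an OPEN subgroup of `Γ_K` acts trivially). For the pinned summand `W* = ↥((W.baseChange K).endEigenPrimaryTorsion 2 π r)` NO open subgroup of
`Γ_K` acts trivially (the CM character has infinite image), but an open subgroup of the LINE's group does: by the frame lemma
`LineKernelOfFrame.mem_kerSubgroup_iff_smul_of_frame` every `σ ∈ ker κ₂` acts on `W*` by `+1` or by `−1` (`κ₂` unramified outside `v̄`, inertia at `v`
pinned to `±1`), so `T := ker κ₂ ∩ Stab(x₀)` for an `x₀ ∈ W*` of order `4` acts TRIVIALLY and has index `≤ 2` in `ker κ₂`. -w5 g4's chain then runs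
verbatim: `W* ≃+ ℚ₂/ℤ₂` (`Cocyclic.nonempty_addEquiv_qpModZp` ∘ `RubinValueTwoTwist.cocyclic_pinnedSummand`), Tate through the layers
(`subsingleton_H2_trivial_ker_inf_of_isOpen` with `hTate_holds`), transport to `T`, `cd₂(ker κ₂) ≤ 2` and the index descent
`subsingleton_H2_of_isOpen_of_subsingleton_restrict`.
* **`subsingleton_H2_kerSubgroup_pinnedSummand_of_frame`** — `H²(Gal(K̄/K*_∞), W*) = 0` on every road-α frame line `κ₂`;
consequently (with p700332) **(REG_W) ⟸ (LSₙ)(W*) alone** (stated by name in the next file of the chain once p700332 lands).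
presearch: Serre–Durham §6.5 Thm. 4 (Tate), Serre I §2.2 Prop. 8, I §2.4 Prop. 9, II §4.4; Greenberg 2006 p. 344; held; tree: -w5 g4 `…H2AboveLineOfTate`,
`…H2AboveLineTateHolds`. No new fact. beyond-print theorem: no.

References: [SerreDurham1977] §6.5 Thm. 4; [SerreGaloisCohomology1997] I §2.2 Prop. 8, I §2.4 Prop. 9, II §4.4 Prop. 13; [Greenberg2006] p. 344;
[Rubin1991] §4 p. 36.
-/

noncomputable section

open scoped Classical

set_option linter.dupNamespace false
set_option autoImplicit false

open CategoryTheory Field NumberField IsDedekindDomain WeierstrassCurve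
open Literature.NumberTheory.GaloisRepresentations Literature.NumberTheory.IwasawaTheory
open Literature.NumberTheory.EllipticCurves hiding subgroupIncl
open Summit.BirchSwinnertonDyer.Rank1Residual.X11b.ProcyclicDescent
open Summit.BirchSwinnertonDyer.BirchSwinnertonDyer.Theorems.PrintCf2.H2AboveLine

namespace Summit.BirchSwinnertonDyer.BirchSwinnertonDyer.Theorems.PrintCf2.UpperBaseLift

variable {K : Type} [Field K] [NumberField K]

/-- **`H²(Gal(K̄/K*_∞), W*) = 0` FOR THE PINNED SUMMAND ON THE FRAME.** For `K` imaginary quadratic, `2 = v v̄`, a road-α frame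
(`C • W = E_d`, `π² = π − 2`, `r² = r − 2`, inertia at `v` acting on `W* = ↥((W.baseChange K).endEigenPrimaryTorsion 2 π r)` by `±1`) and a
`ℤ₂`-line `κ₂` UNRAMIFIED OUTSIDE `v̄`: `Subsingleton (continuousCohomology 2 (discreteTopRep κ₂.kerSubgroup W*))`. Proof = -w5 g4's leaf-(A′) chain
with the open subgroup `Stab(x₀)` (`x₀ ∈ W*` of order `4`) in place of `ker (unitChar θ)`: `ker κ₂ ∩ Stab(x₀)` acts trivially by the `±1`
dichotomy `LineKernelOfFrame.mem_kerSubgroup_iff_smul_of_frame`. [cite: SerreDurham1977, §6.5 Thm. 4] [cite: SerreGaloisCohomology1997, I §2.4 Prop. 9]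
[cite: Greenberg2006, p. 344 L1–6] -/
theorem subsingleton_H2_kerSubgroup_pinnedSummand_of_frame {d : ℤ} (hd0 : d ≠ 0) (W : WeierstrassCurve ℚ) [W.IsElliptic]
    (C : VariableChange ℚ) (hC : C • W = cm7.quadraticTwist (d : ℚ)) (hK : IsImaginaryQuadratic K)
    (v vbar : HeightOneSpectrum (𝓞 K)) (hv : ((2 : ℕ) : 𝓞 K) ∈ v.asIdeal) (hvbar : ((2 : ℕ) : 𝓞 K) ∈ vbar.asIdeal) (hne : vbar ≠ v)
    (π : (W.baseChange K).endRing) (hrel : (π : AddMonoid.End (W.baseChange K).geomPoints) * π = π - 2) {r : ℤ_[2]} (hr : r * r = r - 2)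
    (hpin : ∀ τ ∈ GreenbergSelmer.inertia v, ∀ x : ↥((W.baseChange K).endEigenPrimaryTorsion 2 π r), τ • x = x ∨ τ • x = -x)
    (κ₂ : ZpExtension K 2) (hκ₂ : κ₂.IsUnramifiedOutside vbar) :
    Subsingleton (continuousCohomology 2
      (discreteTopRep κ₂.kerSubgroup ↥((W.baseChange K).endEigenPrimaryTorsion 2 π r))) := by
  haveI : Fact (Nat.Prime 2) := ⟨Nat.prime_two⟩
  haveI : CompactSpace (absoluteGaloisGroup K) := absoluteGaloisGroup_compactSpace K
  -- the module `W*`: open stabilisers, `2`-primary, torsion, `≃+ ℚ₂/ℤ₂`, divisible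
  have hstab : ∀ m : ↥((W.baseChange K).endEigenPrimaryTorsion 2 π r), IsOpen {g : absoluteGaloisGroup K | g • m = m} := fun m ↦ by
    have h := RestrictedSelmerPair.isOpen_stabilizer_endEigenPrimaryTorsion (W.baseChange K) 2 π r m
    have hset : {τ : absoluteGaloisGroup K | τ • m = m} = (MulAction.stabilizer (absoluteGaloisGroup K) m : Set (absoluteGaloisGroup K)) := by
      ext τ
      rw [Set.mem_setOf_eq, SetLike.mem_coe, MulAction.mem_stabilizer_iff]
    rw [hset]
    exact h
  have hM : IsPrimaryTorsion 2 ↥((W.baseChange K).endEigenPrimaryTorsion 2 π r) :=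
    fun m ↦ RestrictedSelmerPair.exists_pow_smul_endEigenPrimaryTorsion_eq_zero (W.baseChange K) 2 π r m
  have htors : AddMonoid.IsTorsion ↥((W.baseChange K).endEigenPrimaryTorsion 2 π r) := fun m ↦ by
    obtain ⟨k, hk⟩ := hM m
    exact isOfFinAddOrder_iff_nsmul_eq_zero.mpr ⟨2 ^ k, pow_pos (by norm_num) k, hk⟩
  have hcyc := RubinValueTwoTwist.cocyclic_pinnedSummand (K := K) hd0 W C hC π hrel hr
  obtain ⟨eQ⟩ : Nonempty (↥((W.baseChange K).endEigenPrimaryTorsion 2 π r) ≃+ QpModZp 2) :=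
    Literature.GroupTheory.Abelian.Cocyclic.nonempty_addEquiv_qpModZp (p := 2) hM hcyc
  have hdivN : ∀ {N : ℕ}, N ≠ 0 →
      Function.Surjective fun m : ↥((W.baseChange K).endEigenPrimaryTorsion 2 π r) ↦ N • m := by
    intro N hN m
    obtain ⟨y, hy⟩ := NoPseudoNullCut.qpModZp_smul_surjective (p := 2) (c := (N : ℤ_[2])) (Nat.cast_ne_zero.mpr hN) (eQ m)
    refine ⟨eQ.symm y, eQ.injective ?_⟩
    change eQ (N • eQ.symm y) = eQ m
    rw [map_nsmul, AddEquiv.apply_symm_apply, ← Nat.cast_smul_eq_nsmul ℤ_[2] N y]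
    exact hy
  -- the line `Gal(K̄/K*_∞) = ker κ₂`: profinite, `cd₂ ≤ 2`
  haveI : CompactSpace κ₂.kerSubgroup := isCompact_iff_compactSpace.mp κ₂.isClosed_kerSubgroup.isCompact
  have hcd : GroupCdLE κ₂.kerSubgroup 2 2 :=
    groupCdLE_subgroup_of_isClosed_holds (absoluteGaloisGroup K) κ₂.kerSubgroup κ₂.isClosed_kerSubgroup 2 2
      (fieldCdLE_two_of_numberField_holds K 2 (Or.inr hK.2))
  -- the ambient representation and its restriction to the line
  let ρK : ContinuousRep (absoluteGaloisGroup K) ℤ ↥((W.baseChange K).endEigenPrimaryTorsion 2 π r) := discreteRep hstab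
  have hrest : (ρK.restrict (subgroupIncl κ₂.kerSubgroup)).toTopRep =
      discreteTopRep κ₂.kerSubgroup ↥((W.baseChange K).endEigenPrimaryTorsion 2 π r) := rfl
  rw [← hrest]
  -- an element `x₀` of order `4` and its open stabiliser `U₀`
  obtain ⟨x₀, hx₀, -⟩ := hcyc 2
  let U₀ : Subgroup (absoluteGaloisGroup K) := MulAction.stabilizer (absoluteGaloisGroup K) x₀
  have hU₀ : IsOpen (U₀ : Set (absoluteGaloisGroup K)) :=
    RestrictedSelmerPair.isOpen_stabilizer_endEigenPrimaryTorsion (W.baseChange K) 2 π r x₀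
  -- `ker κ₂ ∩ U₀` fixes `W*`: elements of `ker κ₂` act by `±1`, and `−1` does not fix `x₀`
  have hfixT : ∀ σ ∈ κ₂.kerSubgroup ⊓ U₀, ∀ m : ↥((W.baseChange K).endEigenPrimaryTorsion 2 π r), σ • m = m := by
    intro σ hσ m
    obtain ⟨hσK, hσU⟩ := Subgroup.mem_inf.mp hσ
    rcases (RestrictedSelmerPair.mem_kerSubgroup_iff_smul_of_frame hd0 W C hC hK v vbar hv hvbar hne π hrel hr hpin κ₂ hκ₂ σ).1 hσK
      with hplus | hminus
    · exact hplus m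
    · exfalso
      have h1 : σ • x₀ = x₀ := MulAction.mem_stabilizer_iff.mp hσU
      have h3 : x₀ = -x₀ := h1.symm.trans (hminus x₀)
      have h2 : (2 : ℕ) • x₀ = 0 := by
        calc (2 : ℕ) • x₀ = x₀ + x₀ := two_nsmul x₀
          _ = x₀ + -x₀ := by rw [← h3]
          _ = 0 := add_neg_cancel x₀
      have h4 : addOrderOf x₀ ∣ 2 := addOrderOf_dvd_of_nsmul_eq_zero h2
      rw [hx₀] at h4
      exact absurd (Nat.le_of_dvd (by norm_num) h4) (by norm_num)
  -- the open subgroup `T = ker κ₂ ⊓ U₀` of the line, read inside `↥(ker κ₂)`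
  let T : Subgroup κ₂.kerSubgroup := (κ₂.kerSubgroup ⊓ U₀).subgroupOf κ₂.kerSubgroup
  have hTset : (T : Set κ₂.kerSubgroup) = Subtype.val ⁻¹' (U₀ : Set (absoluteGaloisGroup K)) := by
    ext x
    simp only [T, SetLike.mem_coe, Subgroup.mem_subgroupOf, Subgroup.mem_inf, Set.mem_preimage, SetLike.coe_mem, true_and]
  have hT : IsOpen (T : Set κ₂.kerSubgroup) := by
    rw [hTset]
    exact hU₀.preimage continuous_subtype_val
  haveI : Finite (κ₂.kerSubgroup ⧸ T) := Subgroup.quotient_finite_of_isOpen T hT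
  have hidx : T.index ≠ 0 := Subgroup.index_ne_zero_of_finite
  -- `H²(ker κ₂ ⊓ U₀, W*) = 0` with the trivial action: Tate through the layers
  have h1 : Subsingleton (continuousCohomology 2 (ContinuousRep.trivial
      ↥(κ₂.kerSubgroup ⊓ U₀) ℤ ↥((W.baseChange K).endEigenPrimaryTorsion 2 π r)).toTopRep) :=
    subsingleton_H2_trivial_ker_inf_of_isOpen
      (fun U hU ↦ hTate_holds (p := 2) K U hU ↥((W.baseChange K).endEigenPrimaryTorsion 2 π r) ⟨eQ⟩) htors κ₂ _ hU₀
  let e : ↥(κ₂.kerSubgroup ⊓ U₀) ≃ₜ* T :=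
    { toFun := fun x ↦ ⟨⟨x.1, (Subgroup.mem_inf.mp x.2).1⟩, Subgroup.mem_subgroupOf.mpr x.2⟩
      invFun := fun y ↦ ⟨y.1.1, Subgroup.mem_subgroupOf.mp y.2⟩
      left_inv := fun _ ↦ rfl
      right_inv := fun _ ↦ rfl
      map_mul' := fun _ _ ↦ rfl
      continuous_toFun := (continuous_subtype_val.subtype_mk _).subtype_mk _
      continuous_invFun := (continuous_subtype_val.comp continuous_subtype_val).subtype_mk _ }
  have h2 : Subsingleton (continuousCohomology 2
      (ContinuousRep.trivial T ℤ ↥((W.baseChange K).endEigenPrimaryTorsion 2 π r)).toTopRep) :=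
    subsingleton_H2_trivial_of_continuousMulEquiv e h1
  have h3 : Subsingleton (continuousCohomology 2 ((ρK.restrict (subgroupIncl κ₂.kerSubgroup)).restrict (subgroupIncl T)).toTopRep) :=
    subsingleton_H2_restrict_of_forall_apply_eq _ T (fun g hg m ↦ hfixT (g : absoluteGaloisGroup K) (Subgroup.mem_subgroupOf.mp hg) m) h2
  exact subsingleton_H2_of_isOpen_of_subsingleton_restrict _ hcd hM T hT (hdivN hidx) h3

end Summit.BirchSwinnertonDyer.BirchSwinnertonDyer.Theorems.PrintCf2.UpperBaseLift

end
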